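import Summits.HubbardSuperconductivity.HubbardSuperconductivity.Theses.NodalDiracTwist
import Summits.HubbardSuperconductivity.HubbardSuperconductivity.Theorems.NodalDiracTwistTwistCalibrationBdGHolonomy

/-!
# Route `NodalDiracTwist` — support `TwistCalibrationBdG` (stmt-HubbardSuperconductivity-1625)

The item itself: `twistCalibrationBdG_proof : TwistCalibrationBdG`. The inlined `let H` of the item is
by `rfl` the tree's `sourcedSpinTwistedHubbardTorus L 0 μ₀ h` (`SpinTwistedHubbardTorus.lean`); the
first clause (exact positions of the sector ground-state degeneracies: the diagonal quartet `(±c, ±c)`,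
`cos c = cos(L arccos(-μ₀/4))`) is `exists_orthogonal_sector_ground_states_iff` (`…Locus.lean`), the
second (holonomy `-1` around each quartet point) is `holonomy_re_prod_neg` (`…Holonomy.lean`); `c` is
`arccos(cos(L arccos(-μ₀/4))) ∈ (0, π)` by non-resonance (`arccos_cos_mem_Ioo`). The hypothesis `3 ≤ L`
of the item is not needed (everything holds for `L ≥ 1`).

Sources: P. G. de Gennes, *Superconductivity of Metals and Alloys* (1966), Ch. 5; Y. Hatsugai,
J. Phys. Soc. Jpn. 75 (2006) 123601. No definitions.
-/

-- the mandated namespace `Summit.<Summit>.<Problem>.Theorems` repeats `HubbardSuperconductivity`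
-- (single-problem summit, D-0017), which the `dupNamespace` linter flags on every declaration
set_option linter.dupNamespace false

namespace Summit.HubbardSuperconductivity.HubbardSuperconductivity.Theorems.NodalDiracTwist

open Literature.MathematicalPhysics.QuantumLattice

/-- **`TwistCalibrationBdG`** (stmt-HubbardSuperconductivity-1625, support of route NodalDiracTwist): the
BdG calibration of the twist-holonomy dictionary. For every `L ≥ 3` (indeed every `L ≥ 1`),
`μ₀ ∈ (-4, 4)`, `h ≠ 0` with `L·arccos(-μ₀/4) ∉ πℤ`, the `U = 0` d-wave-sourced spin-twisted family
restricted to `ker S^z` has its ground state degenerate EXACTLY at the four diagonal twists `(±c, ±c)`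
of the cell `(-π, π]²`, `cos c = cos(L·arccos(-μ₀/4))` (`exists_orthogonal_sector_ground_states_iff`),
and the cyclic overlap product of unit sector ground states around each of them has negative real part
for all fine discretisations of every loop of radius `r < min(c, π - c)` (`holonomy_re_prod_neg`):
positions `= L × node`, holonomy `-1`. de Gennes (1966) Ch. 5; Hatsugai, J. Phys. Soc. Jpn. 75 (2006)
123601. [folklore] -/
theorem twistCalibrationBdG_proof :
    Summit.HubbardSuperconductivity.HubbardSuperconductivity.Theses.NodalDiracTwist.TwistCalibrationBdG := by
  intro L _ _ μ₀ h hμ₁ hμ₂ hh hres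
  obtain ⟨hc0, hcπ, hcos⟩ := arccos_cos_mem_Ioo (L := L) hres
  refine ⟨Real.arccos (Real.cos (L * Real.arccos (-μ₀ / 4))), hc0, hcπ, hcos, ?_, ?_⟩
  · intro φ hφ0 hφ1
    exact exists_orthogonal_sector_ground_states_iff (L := L) hμ₁ hμ₂ hh hc0.le hcπ.le hcos hφ0 hφ1
  · intro p hp0 hp1 r hr0 hr
    exact holonomy_re_prod_neg (L := L) hμ₁ hμ₂ hh hc0 hcπ hcos hp0 hp1 hr0 hr

end Summit.HubbardSuperconductivity.HubbardSuperconductivity.Theorems.NodalDiracTwist
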